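import Summits.QuantumFields.BalabanUV.T4Continuum.Spine.NE2BalabanConstWitness

/-!
# T⁴ programme, spine node NE2 (U1a) — the connection READING at two profile values: remainder differences for COMMUTING exponentials
# (`‖(e^X − 1 − X) − (e^Y − 1 − Y)‖ ≤ 4‖Y‖‖X − Y‖ + ‖X − Y‖²`) and `‖r_k(θc) − r_k(θc̃)‖ ≤ 6θ²|c − c̃|/n_k`

NE2 formalisation swarm, leaf prover 03 (row B5 lineage; support row «B7.w END WITNESSES», supplier of the fourth file `Spine/NE2BalabanLongWaveWitness`,
split off for the 400-line cap).  With `r_k(t) = w_k(t) − t·A = n_k·(e^{X_k(t)} − 1 − X_k(t))` (`NE2BalabanConstWitness.wexp_sub_eq`), the lattice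
derivative `n_k·(w_k(θc(x)) − w_k(θc(x − e)))` of an `x`-dependent reading splits into the main term `θ·n_k(c − c̃)·A` and `n_k·(r_k(θc) − r_k(θc̃))`;
this file bounds the latter:
 * **`norm_expRem_sub_expRem_le`** (`Y` commutes with `X − Y`, `‖Y‖, ‖X − Y‖ ≤ 1`): Mathlib's `NormedSpace.exp_add_of_commute`, `Real.abs_exp_sub_one_le`,
   the tree's `B7Prop1Explicit.norm_exp_sub_one_le_of_norm_le` ∕ `expRem_le_sq`;
 * **`norm_wexpRem_sub_le`** (`|θ| ≤ ½`, `|c|, |c̃| ≤ 1`, `‖A‖ ≤ 1`): `‖r_k(θc) − r_k(θc̃)‖ ≤ 6θ²·|c − c̃|/n_k`.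

HONEST FRAMING (T4-DAG p. 1).  Elementary; OURS; NE2 NOT proved; spine 0/9; NOT infinite volume ∕ mass gap ∕ Clay.  HONEST DEPENDENCY: continuum YM on T⁴ ⇐
BetaPertH ∧ nine spine estimates (0/9 proved); BetaPertH ⇐ (D1) ∧ (D4) ∧ CAP+tail; G-an2-4 gates asym, D1 and NE2/3/4.  ABSOLUTE RULE kept; no `sorry`.
-/

noncomputable section

open scoped Matrix Matrix.Norms.L2Operator
open NormedSpace

namespace Summit.QuantumFields.BalabanUV.T4Continuum.NE2BalabanWexpDiff

open Literature.MathematicalPhysics.QuantumFieldTheory.Balaban1983to89.B5G183RateUnitTower (lev lev_neZero)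
open Literature.MathematicalPhysics.QuantumFieldTheory.Balaban1983to89.B7Prop1Explicit (norm_exp_sub_one_le_of_norm_le expRem_le_sq)
open Summit.QuantumFields.BalabanUV.T4Continuum.NE2BalabanConstWitness

variable (L : ℕ) [NeZero L] {o : Type*} [Fintype o] [DecidableEq o]

omit [NeZero L] in
/-- **COMMUTING EXPONENTIALS**: `‖(e^X − 1 − X) − (e^Y − 1 − Y)‖ ≤ 4‖Y‖·‖X − Y‖ + ‖X − Y‖²` when `Y` commutes with `X − Y` and `‖Y‖, ‖X − Y‖ ≤ 1`
(`e^X = e^Y e^{X−Y}`, so the difference is `(e^Y − 1)(e^{X−Y} − 1) + (e^{X−Y} − 1 − (X − Y))`). [folklore] -/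
theorem norm_expRem_sub_expRem_le {X Y : Matrix o o ℂ} (hc : Commute Y (X - Y)) (hY : ‖Y‖ ≤ 1) (hZ : ‖X - Y‖ ≤ 1) :
    ‖(exp X - 1 - X) - (exp Y - 1 - Y)‖ ≤ 4 * ‖Y‖ * ‖X - Y‖ + ‖X - Y‖ ^ 2 := by
  letI : NormedAlgebra ℚ (Matrix o o ℂ) := NormedAlgebra.restrictScalars ℚ ℂ (Matrix o o ℂ)
  set Z := X - Y with hZdef
  have hX : X = Y + Z := by rw [hZdef]; abel
  have hexp : exp X = exp Y * exp Z := by rw [hX]; exact exp_add_of_commute hc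
  have e : (exp X - 1 - X) - (exp Y - 1 - Y) = (exp Y - 1) * (exp Z - 1) + (exp Z - 1 - Z) := by
    rw [hexp, hX]; noncomm_ring
  have h1 : ‖exp Y - 1‖ ≤ 2 * ‖Y‖ := by
    refine (norm_exp_sub_one_le_of_norm_le le_rfl).1.trans ?_
    have h := Real.abs_exp_sub_one_le (x := ‖Y‖) (by rwa [abs_of_nonneg (norm_nonneg _)])
    rw [abs_of_nonneg (norm_nonneg _)] at h
    exact (le_abs_self _).trans h
  have h2 : ‖exp Z - 1‖ ≤ 2 * ‖Z‖ := by
    refine (norm_exp_sub_one_le_of_norm_le le_rfl).1.trans ?_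
    have h := Real.abs_exp_sub_one_le (x := ‖Z‖) (by rwa [abs_of_nonneg (norm_nonneg _)])
    rw [abs_of_nonneg (norm_nonneg _)] at h
    exact (le_abs_self _).trans h
  have h3 : ‖exp Z - 1 - Z‖ ≤ ‖Z‖ ^ 2 := (norm_exp_sub_one_le_of_norm_le le_rfl).2.trans (expRem_le_sq (norm_nonneg _) hZ)
  rw [e]
  calc ‖(exp Y - 1) * (exp Z - 1) + (exp Z - 1 - Z)‖ ≤ ‖exp Y - 1‖ * ‖exp Z - 1‖ + ‖exp Z - 1 - Z‖ :=
        (norm_add_le _ _).trans (add_le_add (norm_mul_le _ _) le_rfl)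
    _ ≤ (2 * ‖Y‖) * (2 * ‖Z‖) + ‖Z‖ ^ 2 := add_le_add (mul_le_mul h1 h2 (norm_nonneg _) (by positivity)) h3
    _ = 4 * ‖Y‖ * ‖X - Y‖ + ‖X - Y‖ ^ 2 := by rw [hZdef]; ring

/-- **THE READING REMAINDERS AT TWO PROFILE VALUES**: with `r_k(t) = w_k(t) − t·A = n_k·(e^{X_k(t)} − 1 − X_k(t))` (`NE2BalabanConstWitness.wexp_sub_eq`),
`‖r_k(θc) − r_k(θc̃)‖ ≤ 6θ²·|c − c̃|/n_k` for `|θ| ≤ ½`, `|c|, |c̃| ≤ 1`, `‖A‖ ≤ 1`. [folklore] -/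
theorem norm_wexpRem_sub_le {A : Matrix o o ℂ} (hA : ‖A‖ ≤ 1) {θ : ℝ} (hθ : |θ| ≤ 1 / 2) {c c' : ℝ} (hc : |c| ≤ 1) (hc' : |c'| ≤ 1) (k : ℕ) :
    ‖(wexp L (θ * c) A k - ((θ * c : ℝ) : ℂ) • A) - (wexp L (θ * c') A k - ((θ * c' : ℝ) : ℂ) • A)‖
      ≤ 6 * θ ^ 2 * |c - c'| / ((lev L k : ℕ) : ℝ) := by
  have hn1 := one_le_cast_lev L k
  have hn0 : (0 : ℝ) < ((lev L k : ℕ) : ℝ) := by linarith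
  set n : ℝ := ((lev L k : ℕ) : ℝ) with hn
  set X := xlev L (θ * c) A k with hX
  set Y := xlev L (θ * c') A k with hY
  -- the two exponents are real multiples of `A`
  have hXY : X - Y = (((θ * c - θ * c') / (lev L k : ℕ) : ℝ) : ℂ) • A := by
    rw [hX, hY, xlev, xlev, ← sub_smul, ← Complex.ofReal_sub, ← sub_div]
  have hcomm : Commute Y (X - Y) := by
    rw [hXY, hY, xlev]; exact ((Commute.refl A).smul_left _).smul_right _
  have hnY : ‖Y‖ ≤ |θ| / n := by
    rw [hY, xlev, norm_smul, Complex.norm_real, Real.norm_eq_abs, abs_div, abs_of_pos hn0, abs_mul]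
    calc |θ| * |c'| / n * ‖A‖ ≤ |θ| * 1 / n * 1 := by gcongr
      _ = |θ| / n := by ring
  have hnZ : ‖X - Y‖ ≤ |θ| * |c - c'| / n := by
    rw [hXY, norm_smul, Complex.norm_real, Real.norm_eq_abs, abs_div, abs_of_pos hn0, ← mul_sub, abs_mul]
    exact mul_le_of_le_one_right (by positivity) hA
  have hcc : |c - c'| ≤ 2 := (abs_sub _ _).trans (by linarith)
  have hY1 : ‖Y‖ ≤ 1 := hnY.trans (by rw [div_le_one hn0]; linarith)
  have hZ1 : ‖X - Y‖ ≤ 1 := hnZ.trans (by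
    rw [div_le_one hn0]; nlinarith [abs_nonneg θ, abs_nonneg (c - c')])
  have hrem := norm_expRem_sub_expRem_le hcomm hY1 hZ1
  have e : (wexp L (θ * c) A k - ((θ * c : ℝ) : ℂ) • A) - (wexp L (θ * c') A k - ((θ * c' : ℝ) : ℂ) • A)
      = ((n : ℝ) : ℂ) • ((exp X - 1 - X) - (exp Y - 1 - Y)) := by
    rw [wexp_sub_eq, wexp_sub_eq, ← smul_sub]
  rw [e, norm_smul, Complex.norm_real, Real.norm_of_nonneg hn0.le]
  have hθ0 := abs_nonneg θ
  have hd0 := abs_nonneg (c - c')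
  calc n * ‖(exp X - 1 - X) - (exp Y - 1 - Y)‖ ≤ n * (4 * ‖Y‖ * ‖X - Y‖ + ‖X - Y‖ ^ 2) :=
        mul_le_mul_of_nonneg_left hrem hn0.le
    _ ≤ n * (4 * (|θ| / n) * (|θ| * |c - c'| / n) + (|θ| * |c - c'| / n) ^ 2) :=
        mul_le_mul_of_nonneg_left (add_le_add
          (mul_le_mul (mul_le_mul_of_nonneg_left hnY (by norm_num)) hnZ (norm_nonneg _) (by positivity))
          (pow_le_pow_left₀ (norm_nonneg _) hnZ 2)) hn0.le
    _ = θ ^ 2 * |c - c'| * (4 + |c - c'|) / n := by rw [← sq_abs θ]; field_simp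
    _ ≤ θ ^ 2 * |c - c'| * (4 + 2) / n := by gcongr
    _ = 6 * θ ^ 2 * |c - c'| / n := by ring

end Summit.QuantumFields.BalabanUV.T4Continuum.NE2BalabanWexpDiff

end
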